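import Summits.QuantumFields.BalabanUV.Beta.D1BFx.GhostLeg
import Literature.MathematicalPhysics.QuantumFieldTheory.Balaban1983to89.Beta.KernelReflection

/-!
# `BalabanUV.Beta.D1BFx.GhostLegReflection` — road «BF-x» for binder row D1, sub-leaf A4-leg-PARITY-gh (part 1): THE GHOST LEG IS
# INVARIANT UNDER EVERY BLOCK-COMPATIBLE LATTICE REFLECTION — the `hAr` socket of the parity END
# `FineHessianReflection.bondSecondMoment_Pgh_eq_avgM2_of_refl`, discharged for the T2 leg `Ggh n a`

HONEST DEPENDENCY (page 1, mandatory): continuum YM on T⁴ ⇐ BetaPertH ∧ nine spine estimates (0/9 proved); BetaPertH ⇐ (D1) ∧ (D4) ∧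
CAP+tail; G-an2-4 gates asym, D1 and NE2/3/4.  HONEST FRAMING (cell contract, verbatim): «discharging `BetaPertH` makes Bałaban's UV
stability UNCONDITIONAL — a real constructive-QFT result; it is NOT the continuum limit and NOT the Clay problem.»  THIS FILE DISCHARGES
NOTHING of D1 / BetaPertH: it is [folklore] bookkeeping about the road's OWN typed objects (the typer's T2 leg `GhostLeg.Ggh`, an5's
`KernelReflection.refK`); 0 binders of the hR root are touched; no `def … : Prop`, no citation, no printed statement as hypothesis.
ABSOLUTE RULE (cell charter, verbatim): «No internally-minted statement may enter as a cited fact. Every hypothesis is either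
kernel-proved in this package or a verbatim quotation of a PUBLISHED theorem with page reference. The manuscript(s) under audit are NOT
citable for their own disputed steps — they are the thing under adjudication; programme-internal (2001/route/tribunal) claims are never
citable.»

WHY (skeleton `HOME/beta/skeletons/D1-b2b-balaban-beta-d1-p2.md` v1.4 node R5 «(T1) vanishing first moments for the `μ ≠ ν` channel
(reflection parity of the one-shot system: an5 `KernelReflection`, `bref`/`refK` sockets)»).  Gen 2 of this seat reduced the parity input
`hinv` of the A4 / K-R5 ENDs to three sockets ON THE PRIMITIVE DATA (`FineHessianReflection.bondSecondMoment_Pgh_eq_avgM2_of_refl`):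
a leg relabelling `Φ : KernelReflection.LegMap 4 Unit` FIXING THE GHOST LEG, `hAr : refK Φ (Ggh n a) = Ggh n a`, and inversion-type
laws for T6's stencil and contact table.  This file supplies the leg relabellings and discharges `hAr` for all of them at once.

CONTENT (all [folklore] / [our object]; `d`-generic where the lineage's objects are).
* §1 **`Gk_relabel`**: for ANY bijection `r` of `ℤ^d` preserving the site matrix `AX m a` of `Δ^η + a·Q′*Q′` (`0 < a`), the
  whole-lattice inverse kernel is `r`-invariant: `Gk m a (r p) (r q) = Gk m a p q` — the typer's `GhostLeg.Gk_translate` argument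
  verbatim (the relabelled kernel is again a bounded right inverse; the bounded inverse on `ℤ^d` is unique,
  `B4Sect5Exhaustion.eq_limInv_of_right_inverse`) with the translation `Equiv.addRight` replaced by `r`.
* §2 [our object] THE BLOCK-COMPATIBLE REFLECTIONS `reflAt S m : ℤ^d ≃ ℤ^d`, `x_μ ↦ (side m − 1) − x_μ` on the axes `μ ∈ S`, `x_μ`
  elsewhere (`S = {α}`: the block-compatible axis reflection of an5's X-an5-17; `S = univ`: the POINT INVERSION about the centre of the
  block `{0,…,side m − 1}^d`); they are involutions, map `m`-blocks to `m`-blocks (`blk_reflAt`: block labels are negated on `S`),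
  fix `lapKer` and `sameBlk m`, hence `AX m a` (`AX_reflAt`) and `Gk m a` (`Gk_reflAt`).
* §3 [our object] the same bijection as a leg relabelling `reflLeg S n s : LegMap 4 F` (one bijection for every leg type, arbitrary
  signs `s` with `s a · s a = 1`), road units `reflAt S (n − 1) x μ = (n − 1) − x μ` on `S` (`reflAt_pred_apply`), the point inversion
  `invLeg n := reflLeg univ n 1`; **`refK_reflLeg_Ggh`** / **`refK_invLeg_Ggh`**: `refK Φ (Ggh n a) = Ggh n a` for every one of them,
  every `n ≥ 1`, every `0 < a` — the `hAr` socket of `bondSecondMoment_Pgh_eq_avgM2_of_refl` DISCHARGED for the ghost leg.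
NOT HERE (honest): the gluon leg `GluonLeg.Ga` (= an5's explicit symbol kernels `Kinf`; a different proof); the stencil / table laws
`hSr` / `hTr` (part 2 `GhostStencilReflection`, where two of them come out NEGATIVE for T6 v1 as typed); any Ward row; anything printed.
Unit `b2b-balaban-beta-d1-formalise-leaf-01` (gen 3).
-/

noncomputable section

namespace Summit.QuantumFields.BalabanUV.Beta.D1BFx.GhostLegReflection

open Finset
open scoped BigOperators
open Literature.MathematicalPhysics.QuantumFieldTheory.Balaban1983to89
open Literature.MathematicalPhysics.QuantumFieldTheory.Balaban1983to89.Beta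
open B4Sect5Exhaustion (limInv eq_limInv_of_right_inverse)
open B6QGQLower276 (X e side blk lapDir lapKer sameBlk AX Aker hyp56Z_Aker c0 c0_pos side_facts)
open B6QGQDecay237 (deltaU deltaU_pos)
open B5Hk103ScalarZd (Gk toK abs_Gk_le sum_AX_mul_Gk tsum_AX_mul)
open ExpKernelCalculus (Site MKer)
open KernelReflection (LegMap refK refK_apply)
open Summit.QuantumFields.BalabanUV.Beta.D1BFx.GhostLeg (Ggh Ggh_apply side_pred const_nonneg)

variable {d : ℕ}

/-! ## §1 Uniqueness transport: the whole-lattice inverse is invariant under every symmetry of the site matrix -/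

/-- [folklore] **`Gk` IS INVARIANT UNDER EVERY BIJECTION OF `ℤ^d` PRESERVING THE SITE MATRIX** `AX m a` of `Δ^η + a·Q′*Q′`
(`0 < a`): `Gk m a (r p) (r q) = Gk m a p q`.  Proof = `GhostLeg.Gk_translate`'s: `(p, q) ↦ Gk (r p) (r q)` is a bounded right
inverse of the (`r`-invariant) site matrix, and the bounded inverse kernel on `ℤ^d` is unique
(`B4Sect5Exhaustion.eq_limInv_of_right_inverse`). -/
theorem Gk_relabel (m : ℕ) {a : ℝ} (ha : 0 < a) (r : X d ≃ X d) (hr : ∀ p q : X d, AX m a (r p) (r q) = AX m a p q)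
    (p q : X d) : Gk (d := d) m a (r p) (r q) = Gk (d := d) m a p q := by
  have hγ : 0 < min 2 a := lt_min two_pos ha
  have hc : 0 < c0 d m a := c0_pos d m ha.ne'
  have hbd : ∀ p' q' : B4Sect5Exhaustion.K d 1, |Gk (d := d) m a (r p'.1) (r q'.1)| ≤ 2 / min 2 a := fun p' q' => by
    refine (abs_Gk_le m ha _ _).trans (mul_le_of_le_one_right (const_nonneg a ha) ?_)
    rw [Real.exp_le_one_iff, neg_nonpos]
    have := deltaU_pos d ha
    positivity
  have hinv : ∀ p' r' : B4Sect5Exhaustion.K d 1, p'.1 ∈ (Set.univ : Set (X d)) → r'.1 ∈ (Set.univ : Set (X d)) →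
      ∑' q' : B4Sect5Exhaustion.K d 1, Aker m a p' q' * Gk (d := d) m a (r q'.1) (r r'.1) = if p' = r' then 1 else 0 := by
    intro p' r' _ _
    have h1 : ∑' q' : B4Sect5Exhaustion.K d 1, Aker m a p' q' * Gk (d := d) m a (r q'.1) (r r'.1)
        = ∑' x : X d, AX m a p'.1 x * Gk (d := d) m a (r x) (r r'.1) := by
      rw [← Equiv.tsum_eq (toK (d := d))]
      rfl
    have h2 : ∀ x : X d, AX m a p'.1 x * Gk (d := d) m a (r x) (r r'.1) = AX m a (r p'.1) (r x) * Gk (d := d) m a (r x) (r r'.1) :=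
      fun x => by rw [hr]
    have h3 : ∑' x : X d, AX m a (r p'.1) (r x) * Gk (d := d) m a (r x) (r r'.1)
        = ∑' y : X d, AX m a (r p'.1) y * Gk (d := d) m a y (r r'.1) :=
      r.tsum_eq (fun y => AX m a (r p'.1) y * Gk (d := d) m a y (r r'.1))
    rw [h1, tsum_congr h2, h3, tsum_AX_mul m a (r p'.1) (fun y => Gk (d := d) m a y (r r'.1)), sum_AX_mul_Gk m ha]
    have hiff : r p'.1 = r r'.1 ↔ p' = r' := by
      rw [r.apply_eq_iff_eq]
      exact ⟨fun h => Prod.ext h (Subsingleton.elim _ _), fun h => by rw [h]⟩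
    simp only [hiff]
  exact eq_limInv_of_right_inverse hγ hc one_pos (hyp56Z_Aker (d := d) m a)
    (D := fun p' q' : B4Sect5Exhaustion.K d 1 => Gk (d := d) m a (r p'.1) (r q'.1))
    (M := 2 / min 2 a) hbd (fun p' q' h => absurd (Set.mem_univ _) h) hinv (p := (p, 0)) (s := (q, 0))
    (Set.mem_univ _) (Set.mem_univ _)

/-! ## §2 The block-compatible reflections of `ℤ^d` -/

/-- [our object] **THE BLOCK-COMPATIBLE REFLECTION** on the axes `S`: `x_μ ↦ (side m − 1) − x_μ` for `μ ∈ S`, `x_μ` otherwise — the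
reflection of the block `{0, …, side m − 1}^d` onto itself along the axes of `S` (`S = {α}`: one axis; `S = univ`: the point inversion
about the block centre).  A definition; asserts nothing. -/
def reflFun (S : Finset (Fin d)) (m : ℕ) (x : X d) : X d := fun μ => if μ ∈ S then (side m - 1) - x μ else x μ

/-- [our object] Unfolding `reflFun`. -/
theorem reflFun_apply (S : Finset (Fin d)) (m : ℕ) (x : X d) (μ : Fin d) :
    reflFun S m x μ = if μ ∈ S then (side m - 1) - x μ else x μ := rfl

/-- [folklore] The reflection is an involution. -/
theorem reflFun_reflFun (S : Finset (Fin d)) (m : ℕ) (x : X d) : reflFun S m (reflFun S m x) = x := by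
  funext μ
  by_cases h : μ ∈ S <;> simp [reflFun_apply, h]

/-- [our object] **THE BLOCK-COMPATIBLE REFLECTION AS A BIJECTION** `reflAt S m : ℤ^d ≃ ℤ^d` (its own inverse). -/
def reflAt (S : Finset (Fin d)) (m : ℕ) : X d ≃ X d where
  toFun := reflFun S m
  invFun := reflFun S m
  left_inv := reflFun_reflFun S m
  right_inv := reflFun_reflFun S m

/-- [our object] Unfolding `reflAt`. -/
theorem reflAt_apply (S : Finset (Fin d)) (m : ℕ) (x : X d) (μ : Fin d) :
    reflAt S m x μ = if μ ∈ S then (side m - 1) - x μ else x μ := rfl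

/-- [folklore] On a reflected axis. -/
theorem reflAt_apply_of_mem {S : Finset (Fin d)} (m : ℕ) (x : X d) {μ : Fin d} (h : μ ∈ S) :
    reflAt S m x μ = (side m - 1) - x μ := by
  rw [reflAt_apply, if_pos h]

/-- [folklore] Off the reflected axes. -/
theorem reflAt_apply_of_not_mem {S : Finset (Fin d)} (m : ℕ) (x : X d) {μ : Fin d} (h : μ ∉ S) :
    reflAt S m x μ = x μ := by
  rw [reflAt_apply, if_neg h]

/-- [folklore] `reflAt` is its own inverse. -/
theorem reflAt_symm (S : Finset (Fin d)) (m : ℕ) : (reflAt S m).symm = reflAt S m := rfl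

/-- [folklore] `reflAt S m (reflAt S m x) = x`. -/
theorem reflAt_reflAt (S : Finset (Fin d)) (m : ℕ) (x : X d) : reflAt S m (reflAt S m x) = x := reflFun_reflFun S m x

/-- [folklore] THE BLOCK ARITHMETIC: for `0 < s`, `((s − 1) − x) / s = −(x / s)` (floor division) — the reflection
`x ↦ (s − 1) − x` of `ℤ` maps the block `{s·b, …, s·b + s − 1}` onto the block `{s·(−b), …, s·(−b) + s − 1}`. -/
theorem sub_one_sub_ediv {s : ℤ} (hs : 0 < s) (x : ℤ) : ((s - 1) - x) / s = -(x / s) := by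
  have h1 : (s - 1) - x = ((s - 1) - x % s) + s * (-(x / s)) := by
    have := Int.emod_add_ediv_mul x s
    linarith
  have h2 : 0 ≤ (s - 1) - x % s := by
    have := Int.emod_lt_of_pos x hs
    linarith
  have h3 : (s - 1) - x % s < s := by
    have := Int.emod_nonneg x hs.ne'
    linarith
  rw [h1, Int.add_mul_ediv_left _ _ hs.ne', Int.ediv_eq_zero_of_lt h2 h3, zero_add]

/-- [folklore] **BLOCKS GO TO BLOCKS**: the block label of the reflected site is the reflected-about-zero block label,
`blk m (reflAt S m x) μ = −(blk m x μ)` on `S`, `blk m x μ` elsewhere. -/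
theorem blk_reflAt (S : Finset (Fin d)) (m : ℕ) (x : X d) (μ : Fin d) :
    blk m (reflAt S m x) μ = if μ ∈ S then -(blk m x μ) else blk m x μ := by
  show reflAt S m x μ / side m = _
  by_cases h : μ ∈ S
  · rw [reflAt_apply_of_mem m x h, if_pos h, sub_one_sub_ediv (side_facts m).1]
    rfl
  · rw [reflAt_apply_of_not_mem m x h, if_neg h]
    rfl

/-- [folklore] Two sites lie in the same block iff their reflections do. -/
theorem blk_reflAt_eq_iff (S : Finset (Fin d)) (m : ℕ) (p q : X d) :
    blk m (reflAt S m p) = blk m (reflAt S m q) ↔ blk m p = blk m q := by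
  constructor
  · intro h
    funext μ
    have hμ := congr_fun h μ
    rw [blk_reflAt, blk_reflAt] at hμ
    by_cases hS : μ ∈ S
    · rw [if_pos hS, if_pos hS] at hμ
      exact neg_injective hμ
    · rw [if_neg hS, if_neg hS] at hμ
      exact hμ
  · intro h
    funext μ
    rw [blk_reflAt, blk_reflAt, h]

/-- [folklore] The same-block indicator is reflection invariant. -/
theorem sameBlk_reflAt (S : Finset (Fin d)) (m : ℕ) (p q : X d) :
    sameBlk m (reflAt S m p) (reflAt S m q) = sameBlk m p q := by
  simp only [sameBlk, blk_reflAt_eq_iff]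

/-- [folklore] Reflections are injective (as an `iff` on equality of images). -/
theorem reflAt_eq_iff (S : Finset (Fin d)) (m : ℕ) (p q : X d) : reflAt S m p = reflAt S m q ↔ p = q :=
  (reflAt S m).apply_eq_iff_eq

/-- [folklore] A reflected site is a translate `p + v` iff the original is the translate by the REFLECTED vector:
`reflAt q = reflAt p + v ↔ q = p + σv`, `(σv)_μ = −v_μ` on `S`, `v_μ` elsewhere. -/
theorem reflAt_eq_add_iff (S : Finset (Fin d)) (m : ℕ) (p q v : X d) :
    reflAt S m q = reflAt S m p + v ↔ q = p + fun μ => if μ ∈ S then -v μ else v μ := by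
  constructor
  · intro h
    funext μ
    have hμ := congr_fun h μ
    rw [Pi.add_apply] at hμ
    rw [Pi.add_apply]
    by_cases hS : μ ∈ S
    · rw [reflAt_apply_of_mem m q hS, reflAt_apply_of_mem m p hS] at hμ
      rw [if_pos hS]
      linarith
    · rw [reflAt_apply_of_not_mem m q hS, reflAt_apply_of_not_mem m p hS] at hμ
      rw [if_neg hS]
      exact hμ
  · intro h
    funext μ
    rw [Pi.add_apply, h]
    by_cases hS : μ ∈ S
    · rw [reflAt_apply_of_mem m _ hS, reflAt_apply_of_mem m p hS, Pi.add_apply, if_pos hS]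
      ring
    · rw [reflAt_apply_of_not_mem m _ hS, reflAt_apply_of_not_mem m p hS, Pi.add_apply, if_neg hS]

/-- [folklore] The reflected unit vector: `σ(e_μ) = −e_μ` if `μ ∈ S`, `e_μ` otherwise (as the function of `reflAt_eq_add_iff`). -/
theorem reflVec_e (S : Finset (Fin d)) (μ : Fin d) :
    (fun ν => if ν ∈ S then -(e μ : X d) ν else (e μ : X d) ν) = if μ ∈ S then -(e μ : X d) else e μ := by
  funext ν
  by_cases hν : ν = μ
  · subst hν
    by_cases hS : ν ∈ S
    · rw [if_pos hS, if_pos hS, Pi.neg_apply]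
    · rw [if_neg hS, if_neg hS]
  · have h0 : (e μ : X d) ν = 0 := B6QGQLower276.e_apply_ne hν
    by_cases hS : ν ∈ S
    · rw [if_pos hS, h0, neg_zero]
      by_cases hμ : μ ∈ S
      · rw [if_pos hμ, Pi.neg_apply, h0, neg_zero]
      · rw [if_neg hμ, h0]
    · rw [if_neg hS, h0]
      by_cases hμ : μ ∈ S
      · rw [if_pos hμ, Pi.neg_apply, h0, neg_zero]
      · rw [if_neg hμ, h0]

/-- [folklore] The reflected vector is odd in the vector. -/
theorem reflVec_neg (S : Finset (Fin d)) (v : X d) :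
    (fun ν => if ν ∈ S then -(-v) ν else (-v) ν) = -(fun ν => if ν ∈ S then -v ν else v ν) := by
  funext ν
  simp only [Pi.neg_apply, neg_neg]
  split_ifs <;> simp

/-- [folklore] **THE LAPLACIAN IS REFLECTION INVARIANT**, direction by direction: a reflection exchanges the two neighbours
`p ± e_μ` on a reflected axis and fixes them on the others. -/
theorem lapDir_reflAt (S : Finset (Fin d)) (m : ℕ) (μ : Fin d) (p q : X d) :
    lapDir μ (reflAt S m p) (reflAt S m q) = lapDir μ p q := by
  have h0 : (reflAt S m q = reflAt S m p) = (q = p) := propext (reflAt_eq_iff S m q p)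
  have hplus : (reflAt S m q = reflAt S m p + e μ) = (q = p + if μ ∈ S then -(e μ : X d) else e μ) := by
    rw [← reflVec_e S μ]
    exact propext (reflAt_eq_add_iff S m p q (e μ))
  have hminus : (reflAt S m q = reflAt S m p - e μ) = (q = p - if μ ∈ S then -(e μ : X d) else e μ) := by
    have h := propext (reflAt_eq_add_iff S m p q (-(e μ)))
    rw [reflVec_neg, reflVec_e, ← sub_eq_add_neg, ← sub_eq_add_neg] at h
    exact h
  simp only [lapDir, h0, hplus, hminus]
  by_cases hS : μ ∈ S
  · rw [if_pos hS, sub_neg_eq_add, show p + -(e μ : X d) = p - e μ from rfl]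
    ring
  · rw [if_neg hS]

/-- [folklore] The lattice Laplacian kernel is reflection invariant. -/
theorem lapKer_reflAt (S : Finset (Fin d)) (m : ℕ) (p q : X d) : lapKer (reflAt S m p) (reflAt S m q) = lapKer p q := by
  simp only [lapKer, lapDir_reflAt]

/-- [folklore] **THE SITE MATRIX OF `Δ^η + a·Q′*Q′` IS INVARIANT UNDER THE BLOCK-COMPATIBLE REFLECTIONS.** -/
theorem AX_reflAt (S : Finset (Fin d)) (m : ℕ) (a : ℝ) (p q : X d) :
    AX m a (reflAt S m p) (reflAt S m q) = AX m a p q := by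
  simp only [AX, lapKer_reflAt, sameBlk_reflAt]

/-- [folklore] **THE WHOLE-LATTICE INVERSE IS INVARIANT UNDER THE BLOCK-COMPATIBLE REFLECTIONS** (`0 < a`). -/
theorem Gk_reflAt (S : Finset (Fin d)) (m : ℕ) {a : ℝ} (ha : 0 < a) (p q : X d) :
    Gk (d := d) m a (reflAt S m p) (reflAt S m q) = Gk (d := d) m a p q :=
  Gk_relabel m ha (reflAt S m) (AX_reflAt S m a) p q

/-! ## §3 The leg relabellings and the `hAr` socket for the ghost leg -/

variable {F : Type*}

/-- [our object] **THE BLOCK-COMPATIBLE REFLECTION AS A LEG RELABELLING** at the road's block size `n` (block side `side (n − 1) = n`):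
the same bijection `reflAt S (n − 1)` for every leg type, with arbitrary signs `s` squaring to one (for the `Unit` fibre the signs
cancel in `refK`).  A definition; asserts nothing. -/
def reflLeg (S : Finset (Fin 4)) (n : ℕ) (s : F → ℝ) (hs : ∀ a, s a * s a = 1) : LegMap 4 F where
  r := fun _ => reflAt S (n - 1)
  s := s
  s_mul_s := hs

/-- [our object] **THE BLOCK-COMPATIBLE POINT INVERSION** `x ↦ (n − 1)·𝟙 − x` as a leg relabelling of the `Unit`-fibred (ghost)
kernels, sign `+1`.  A definition; asserts nothing. -/
def invLeg (n : ℕ) : LegMap 4 Unit := reflLeg Finset.univ n (fun _ => 1) (fun _ => one_mul 1)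

/-- [folklore] The bijection of `reflLeg`. -/
theorem reflLeg_r (S : Finset (Fin 4)) (n : ℕ) (s : F → ℝ) (hs : ∀ a, s a * s a = 1) (a : F) :
    (reflLeg S n s hs).r a = reflAt S (n - 1) := rfl

/-- [folklore] The signs of `reflLeg`. -/
theorem reflLeg_s (S : Finset (Fin 4)) (n : ℕ) (s : F → ℝ) (hs : ∀ a, s a * s a = 1) (a : F) :
    (reflLeg S n s hs).s a = s a := rfl

/-- [folklore] The sign of `invLeg` is `+1`. -/
theorem invLeg_s (n : ℕ) (a : Unit) : (invLeg n).s a = 1 := rfl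

variable (n : ℕ) [NeZero n]

/-- [folklore] ROAD UNITS: at block size `n` the reflected coordinate is `(n − 1) − x_μ`. -/
theorem reflAt_pred_apply (S : Finset (Fin 4)) (x : Site 4) (μ : Fin 4) :
    reflAt S (n - 1) x μ = if μ ∈ S then ((n : ℤ) - 1) - x μ else x μ := by
  rw [reflAt_apply, side_pred n]

/-- [folklore] The bijection of `invLeg` in coordinates: `x_μ ↦ (n − 1) − x_μ`. -/
theorem invLeg_r_apply (x : Site 4) (μ : Fin 4) (a : Unit) : (invLeg n).r a x μ = ((n : ℤ) - 1) - x μ := by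
  show reflAt Finset.univ (n - 1) x μ = _
  rw [reflAt_pred_apply n, if_pos (Finset.mem_univ μ)]

omit [NeZero n] in
/-- [folklore] `refK` through a same-bijection relabelling of a `Unit`-fibred kernel: the signs cancel. -/
theorem refK_reflLeg_apply (S : Finset (Fin 4)) (s : Unit → ℝ) (hs : ∀ a, s a * s a = 1) (K : MKer 4 Unit) (x z : Site 4)
    (a b : Unit) : refK (reflLeg S n s hs) K x z a b = K (reflAt S (n - 1) x) (reflAt S (n - 1) z) a b := by
  rw [refK_apply]
  show s a * s b * K (reflAt S (n - 1) x) (reflAt S (n - 1) z) a b = _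
  rw [Subsingleton.elim b a, hs a, one_mul]

variable (a : ℝ)

/-- [folklore] **THE `hAr` SOCKET FOR THE GHOST LEG, EVERY BLOCK-COMPATIBLE REFLECTION**: `refK (reflLeg S n s hs) (Ggh n a) = Ggh n a`
(`0 < a`, every `n ≥ 1`, every axis set `S`, every admissible sign). -/
theorem refK_reflLeg_Ggh (ha : 0 < a) (S : Finset (Fin 4)) (s : Unit → ℝ) (hs : ∀ u, s u * s u = 1) :
    refK (reflLeg S n s hs) (Ggh n a) = Ggh n a := by
  funext x z u v
  rw [refK_reflLeg_apply, Ggh_apply, Ggh_apply]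
  exact Gk_reflAt S (n - 1) ha x z

/-- [folklore] **THE `hAr` SOCKET OF `FineHessianReflection.bondSecondMoment_Pgh_eq_avgM2_of_refl` FOR THE POINT INVERSION**:
`refK (invLeg n) (Ggh n a) = Ggh n a` (`0 < a`, every `n ≥ 1`). -/
theorem refK_invLeg_Ggh (ha : 0 < a) : refK (invLeg n) (Ggh n a) = Ggh n a :=
  refK_reflLeg_Ggh n a ha Finset.univ (fun _ => 1) (fun _ => one_mul 1)

/-- [folklore] The same, entrywise in coordinates: `Ggh n a ((n−1)·𝟙 − x) ((n−1)·𝟙 − z) = Ggh n a x z`. -/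
theorem Ggh_pointInversion (ha : 0 < a) (x z : Site 4) (u v : Unit) :
    Ggh n a (fun μ => ((n : ℤ) - 1) - x μ) (fun μ => ((n : ℤ) - 1) - z μ) u v = Ggh n a x z u v := by
  have h := congr_fun (congr_fun (congr_fun (congr_fun (refK_invLeg_Ggh n a ha) x) z) u) v
  rw [refK_apply, invLeg_s, one_mul, one_mul] at h
  have hx : (invLeg n).r u x = fun μ => ((n : ℤ) - 1) - x μ := funext fun μ => invLeg_r_apply n x μ u
  have hz : (invLeg n).r v z = fun μ => ((n : ℤ) - 1) - z μ := funext fun μ => invLeg_r_apply n z μ v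
  rw [hx, hz] at h
  exact h

/-- [folklore] … and for a single axis `α`: `Ggh n a` is invariant under `x_α ↦ (n − 1) − x_α` (both arguments). -/
theorem Ggh_axisReflection (ha : 0 < a) (α : Fin 4) (x z : Site 4) (u v : Unit) :
    Ggh n a (reflAt {α} (n - 1) x) (reflAt {α} (n - 1) z) u v = Ggh n a x z u v := by
  rw [Ggh_apply, Ggh_apply]
  exact Gk_reflAt {α} (n - 1) ha x z

end Summit.QuantumFields.BalabanUV.Beta.D1BFx.GhostLegReflection

end
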